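import Summits.QuantumFields.YangMills.Theorems.BalabanUVNodesN22AtRecordOfTermDataTableGermsLocatedRadiiDilatedMembers
import Summits.QuantumFields.YangMills.Theorems.BalabanUVNodesN22W1RelCentredMembersOfDatumBound

/-!
# BalabanUVNodes ∕ node N22 = NE9 — THE ROAD-2 SOCKET WITH THE WINDOW-DILATED MEMBER HOLOMORPHY AND (2.26) WEIGHT READ OFF ONE LOCATED RECORD PER SLICE AND BASE POINT
# (module J86 ∘ g7 module J6 `YMDAG.N22.W1.differentiableOn_and_norm_memberOfDatum_le_weight_of_primitives` by name): `hMdiff ∧ hMbd` DISCHARGED from def-W1's located record type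
# `TermDatum214.Inputs226Holo c Z s ↑t old φ a a₅` at the base point `t` + the extras J6 reads beyond it (entrywise decay of `C⁻¹`, Lemma 2's potentials SPLIT into Wilson part and
# older part at the base point, the primed-letter transports of the dilation ball `|b − 1| < ρ_b` and the numerics in the primed letters) — one located family `hιm` in the idiom of
# `hι ∕ hloc18`; the unscaled boxes at the base point are READ OFF the record's box rows by the bill's own unscaled-field law

Cell `pub-ymgap`, HUMAN RULING D-0062 (Track A), R134 seat `pub-ymgap-dag-n22-c` (strategy s1: «the history-Lipschitz estimate (2.40)–(2.41) p. 21 of [II] on the W1 object»), generation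
20, module J87.  THEOREMS ONLY (no `def`, no `sorry`, standard axioms); `--kind proof --supports stmt-QuantumFields-27366 --as helper` (K3⁸ `SpineGivenEndpointR13SepCoPHV`), COUNT-NEUTRAL.
Imports this lane's module J86 `…N22AtRecordOfTermDataTableGermsLocatedRadiiDilatedMembers` (ROAD-2 socket at the members) and g7 module J6 `…N22W1RelCentredMembersOfDatumBound` (through
it node N10's g6 `B13Term214WindowDilated` §4: `differentiableOn_term214_torus_windowDilated_of_primitives`, `h226_torus_windowDilated_of_primitives`).  Nothing re-declared; consumed BY
NAME (dag-n10-c g20 I.44744: «the producer is J6 ∕ J7a ∕ J7b per slice from a located-primitives family — a knit over your own files, yours by lane; N10 owes nothing new»).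

WHY.  After module J86 the last-coupling side of the ROAD-2 bill at def-W1's term data was, per term `(K, k, old, X, φ, Z ⊆ X, s ∈ terms L M Z)` and base point `t ∈ ]0, γ]`, the
WINDOW-DILATED MEMBER statements on `ball 1 ρ_b`: holomorphy `hMdiff` and the (2.26) weight `hMbd` of `b ↦ (𝔇 K).memberTF (χu K) (χcu K) (𝒲 K) (𝒪 K) t k Z s b old φ`, the centre `T₀`
with `hT₀`, the centred `hMcen`.  g7's module J6 proves `hMdiff ∧ hMbd` VERBATIM (W1 `memberTF_apply` is `rfl` on J6's lambda-level member) from LOCATED PRIMITIVE inputs at the base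
point: NODE A's kernel record at the configuration (σ-region `Uσ ⊇` closed `e^{κ₁}`-ball, per-domain τ-regions, Cauchy radius, entrywise σ-holomorphy and symmetry of `A(σ,u)`,
σ-holomorphy of `G(σ,u)`, the (L17a)∕(L16a) letters `K_G K_Γ K_{Cσ} K₀ θ_Γ θ_C θ_E` at rates `κ > κ′ > κ″ > 0`, the column fibre bound), the boxes' signs ∕ measurability ∕ (2.22) shape
(`γ₂ r_P q_P`), Lemma 2 at the base point, the (2.24)–(2.25) smallness (`c_E`, `g`), the constant matching `hPa ∕ hvol` — i.e. EXACTLY the field list of def-W1's located record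
`TermDatum214.Inputs226Holo c Z s ↑t old φ a a₅` (the type of the bill's `hloc18` ∕ `hι` records) read at the coupling `↑t`, PLUS: (x1) `K_E` with the entrywise decay of `C⁻¹`;
(x2) measurability of `𝒲(φ; Y, t·B)` and `𝒪(old, φ; Y, t·B)` and the JOINT (2.20) shape of `|t⁻²𝒲| + |𝒪|` on `Π_Y ι.Uτ Y` with `ι`'s letters `a₂₀, w` (Lemma 2 SPLIT at the base
point — the member dilates the Wilson part by `b²` but not the older part, so the record's (2.20) row for `𝐕 = t⁻²𝒲 + 𝒪` does not suffice); (x3) the PRIMED letters dominating n10-c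
§2's transports over the dilation ball (`(1+ρ_b)K_G ≤ K_G′`, `(1−ρ_b)⁻²K_{Cσ} ≤ K_{Cσ}′`, `θ_Γ + ρ_bK_G ≤ θ_Γ′`, `θ_C + ρ_b(2+ρ_b)(1−ρ_b)⁻²K_{Cσ} ≤ θ_C′`, `θ_E + ρ_b(2+ρ_b)(θ_E + K_E) ≤
θ_E′`, `(1+ρ_b)²a₂₀ ≤ a′`, `(1+ρ_b)²w ≤ w′`) and (x4) the record's numeric rows RE-READ in the primed letters (`θ_E′, θ_Γ′ ≤ θ`, the `θ_{R1}` row, `hαc`, `hsmall`, `hvol` with `a′, w′`;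
`hsmallKθ`, `c_E`, `g`, `hΓq`, `hPa` unchanged).  The record's box rows are about the datum's boxes AT THE COUPLING `↑t` (`chiY₀ Z s ↑t`, `chicP Z s ↑t`); J6 wants the UNSCALED boxes
at the base point (`χu Z s (t • B)`) — the bill's own `hlaw : UnscaledFieldLawOn` identifies them (`chiY₀_eq ∕ chicP_eq`).  THIS FILE displays (x1)–(x4) together with the record as
ONE located family `hιm` (per slice and base point: `∃ ι, ∃ K_E K_G′ K_{Cσ}′ θ_Γ′ θ_C′ θ_E′ a′ w′, 16 conjuncts`) plus `ρ_b < 1`, and instantiates J86 with `hMdiff ∕ hMbd := (J6 …).1 ∕ .2`.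
* §1 ★★★ socket `n22At_u3OfRecord₁₃_of_kernelStepRate_termDataTableGermsLocatedRadiiMembersOfRecordNonexpansive` — binder diff vs J86: `hMdiff hMbd` OUT; `hρb1 : ρ_b < 1`, `hιm` IN.
THE N22 ROAD-2 BILL AT def-W1's TERM DATA AFTER J87: N18's rate `h5`; (1.21) `hlim`; W1-20's law `hloc`; NODE A's located (2.26) records `hι` (N10 per-slice, τ-radii margin), `hloc18`
(N18 per-step) AND NOW `hιm` (per slice and base point: the same record type + (x1)–(x4)); def-W1's laws (`UnscaledFieldLawOn`, `ReadsBy` + atom regularity, `MapsToTables … univ` on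
windows `W ⊇ sp`, `𝒲` measurable); the z-free centre `T₀` with `hT₀` and the centred member letter `hMcen` (UNPRINTED as an estimate: [I] (2.13) p. 268 «vanishes at g_k = 0», the
second order = the producer's centred (2.15), lens T21 — producers J7b `norm_memberOfDatum_sub_boxedCentre_le_of_primitives` + J7a tails + J1 §4 `centred_of_twoStep`); chart DATA;
numerics (+ `0 < c_S < c_A < 1`, `c_A∕(1−c_A) < ρ_b < 1`, `0 ≤ M_v`, `hBqv` at `C_q = (1−c_A)⁻²M_v`); standing rows as in J79.  AFTER THIS FILE the holomorphy-and-weight half of the last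
coupling is keyed on NODE A's located primitive letters — the same currency as the older-term side.

HONEST FRAMING (binding).  Count-neutral INSTANCE of module J86 BY NAME with g7 J6 (one application per slice; five rewrites by the law); `hιm`, `hT₀`, `hMcen`, the located records,
the laws, the chart data, the numerics and every other binder are DISPLAYED HYPOTHESES (NODE A's located primitive inputs are the N10 ∕ N18 lanes' standing displayed class; GAPS
G-ne9p2-5 ∕ G-t4-U3-1); NO estimate of Bałaban's is proved or asserted; nothing of the record is constructed or claimed to meet the displayed inputs.  N18, N10 and N22 are NOT
discharged (typed 28∕28; count 7∕27 per dag-lead TABLE — N22 unchanged); K3⁸ OPEN and NOT claimed; NE9 ∕ NE5 NOT IN PRINT for d = 4; no count claim; one finite 𝕋⁴ programme at fixed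
ε — R4 closes the CONDITIONAL rung `BalabanLadder.UV` only; NOTHING about the continuum limit, ℝ⁴, infinite volume, OS axioms, a mass gap or the Clay problem is proved or claimed.
References (TYPES only): [II] = Bałaban, CMP 116 (1988) Lemma 2 p. 11, (1.41) p. 11, (2.13)–(2.15) pp. 14–15, (2.16)–(2.22) p. 16, (2.23)–(2.26) p. 17, Lemma 3 (2.38) p. 20,
(2.39)–(2.41) p. 21; [I] = CMP 109 (1987) §1 p. 263, (1.17)–(1.18) p. 263, (2.9)–(2.13) pp. 266–268; [13] (1.43); Kotecký–Preiss, CMP 103 (1986) Thm p. 492; King, CMP 102 (1986)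
Lemma 4.5 (4.38).
-/

noncomputable section

open Set Metric
open scoped BigOperators

namespace YMDAG.N22.KernelFading

open Literature.MathematicalPhysics.QuantumFieldTheory.Balaban1983to89
open Literature.MathematicalPhysics.QuantumFieldTheory.Balaban1983to89.T4Continuum (T4Family ULoop)
open Literature.MathematicalPhysics.QuantumFieldTheory.Balaban1983to89.T4OutputRate (Window NE9)
open Literature.MathematicalPhysics.QuantumFieldTheory.Balaban1983to89.TreeLengthTorus (TPt TDom tsys torusTreeLen)
open Literature.MathematicalPhysics.QuantumFieldTheory.Balaban1983to89.B9Thm37GlueTorus (tdist1)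
open Literature.MathematicalPhysics.QuantumFieldTheory.Balaban1983to89.B12TreeDecay (K₀ kappa₀)
open Literature.MathematicalPhysics.QuantumFieldTheory.Balaban1983to89.B12Decay510 (delta1)
open Literature.MathematicalPhysics.QuantumFieldTheory.Balaban1983to89.B12Decay510Window (K₁)
open Literature.MathematicalPhysics.QuantumFieldTheory.Balaban1983to89.B12Decay510Torus (distCT nearT)
open Literature.MathematicalPhysics.QuantumFieldTheory.Balaban1983to89.B13Lemma3TorusData (TBond)
open Literature.MathematicalPhysics.QuantumFieldTheory.Balaban1983to89.B13Lemma3TorusTerms (terms weight)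
open Literature.MathematicalPhysics.QuantumFieldTheory.Balaban1983to89.B13Lemma3TorusSocket (Lemma3Numerics)
open Literature.MathematicalPhysics.QuantumFieldTheory.Balaban1983to89.B13OlderTermsTableGerms (Pot cv ρ)
open Literature.MathematicalPhysics.QuantumFieldTheory.Balaban1983to89.Node00 (Stage13Params Stage13HParams U3Letters₁₁ MatA)
open Literature.MathematicalPhysics.QuantumFieldTheory.Balaban1983to89.Node00.Sect2 (domSys domCount CPair)
open Literature.MathematicalPhysics.QuantumFieldTheory.Balaban1983to89.Node00.W1
open Literature.MathematicalPhysics.QuantumFieldTheory.Balaban1983to89.Node00.LocalizedSum17 (ReadingMaps Localizes17OfRecord₁₃)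
open Literature.MathematicalPhysics.QuantumFieldTheory.Balaban1983to89.Node00.U3OfKernels (histPrefix objectsOfRecord₁₃)
open Literature.MathematicalPhysics.QuantumFieldTheory.Balaban1983to89.Node00.U3KernelLetters (KernelStepRateOfRecord₁₃ PolLimitsExistOfRecord₁₃)
open YMDAG.UVSplit (N22At u3OfRecord₁₃ RateReading₁₃CoPH rateCarriersOfRecord₁₃CoPH)
open YMDAG.N22.AtKernels (n22At_u3OfRecord₁₃_objectsOfRecord₁₃_iff)
open YMDAG.N10 (lastCouplingSectors_ofTerms_of_termSectors)
open YMDAG.N22.TermRecursion (genT1last_of_lastSectorHolo genT2last_of_lastSectorHolo)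

open YMDAG.N22.W1 (isOpen_relSector closedBall_subset_relSector differentiableOn_relSector_of_members norm_le_relSector_of_members
  norm_sub_le_sq_relSector_of_members)

open YMDAG.N22.W1 (differentiableOn_and_norm_memberOfDatum_le_weight_of_primitives)

open scoped Matrix Matrix.Norms.L2Operator

variable (F : T4Family) (N : ℕ) [NeZero N] {𝔸 : Type} [NormedRing 𝔸] [NormedAlgebra ℂ 𝔸]

/-! ## §1 ★★★ The kernel-face socket with the member holomorphy ∕ (2.26) weight READ OFF ONE located record per slice and base point (g7 J6 by name) -/

open Classical Finset in
/-- ★★★ **THE ROAD-2 KERNEL-FACE SOCKET WITH THE MEMBER HOLOMORPHY ∕ (2.26) WEIGHT READ OFF ONE LOCATED RECORD PER SLICE AND BASE POINT** — module J86 with `hMdiff ∕ hMbd :=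
(differentiableOn_and_norm_memberOfDatum_le_weight_of_primitives (𝔇 K k) (χu K k) (χcu K k) (𝒲 K k) (𝒪 K k) c … t ι.… …).1 ∕ .2` per slice, `ι : (𝔇 K k).Inputs226Holo c Z s ↑t old φ a a₅`
and the extras (x1)–(x4) from the located family `hιm`, the unscaled boxes at `t` by `hlaw` (`chiY₀_eq ∕ chicP_eq`) ⟹ **`N22At (u3OfRecord₁₃ θ (objectsOfRecord₁₃ F N θ ℓ) k)` for
EVERY run length `k`** (dag-n27-c's `h22` row; plug = J86's list with `hMdiff hMbd ↦ hρb1 hιm`).  LOCATED (hypothesis form); N22 NOT discharged. [folklore] -/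
theorem n22At_u3OfRecord₁₃_of_kernelStepRate_termDataTableGermsLocatedRadiiMembersOfRecordNonexpansive (θ : Stage13Params F N) (ℓ : U3Letters₁₁) (hs : ℓ.Signs) (hγ : 0 < θ.γ)
    (hlim : PolLimitsExistOfRecord₁₃ F N θ) {κ₅ C₅ : ℝ} (hC₅ : 0 ≤ C₅) (h5 : KernelStepRateOfRecord₁₃ F N θ κ₅ ℓ.θ₅ C₅)
    (m' : ℕ) (M : ℕ) [NeZero M] (hM : M = F.L ^ m')
    {c₀ : B13.Consts} {L : ℕ} [NeZero L] (𝔇 : (K : ℕ) → TermData214 c₀ (F.P K) 𝔸 M L) (emb : ReadingMaps F (MatA N) 𝔸)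
    (hloc : Localizes17OfRecord₁₃ F N θ (fun K => truncRun K (toClusterTower (𝔇 K).Gn)) emb)
    (sp : (K j : ℕ) → (domSys (F.P K) M j).Dom → Set (CPair (F.P K) 𝔸))
    (hsp : ∀ (K j : ℕ) (Y : (domSys (F.P K) M j).Dom), IsOpen (sp K j Y))
    {κ κE δ₀ B₃ r R E₀ ϱ Mb cw cS Bq r₁ : ℝ} {aw : ℕ → ℕ → ℕ → ℝ}
    (hκ₀ : kappa₀ (4 * 2 ^ 4) (2 * 4) ≤ κ / 2) (hδ₀ : 0 < δ₀) (hB₃ : 0 ≤ B₃) (hr : 0 < r) (hκE : κ ≤ κE) (hκE0 : 0 ≤ κE) (hE₀ : 0 ≤ E₀)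
    (big : (K j : ℕ) → (domSys (F.P K) M j).Dom → Set (CPair (F.P K) 𝔸))
    (hbigo : ∀ (K k : ℕ) (Z : (domSys (F.P K) M (k + 1)).Dom), IsOpen (big K (k + 1) Z))
    (hrestr : ∀ (K k : ℕ), SpRestr (sp K (k + 1))) (hbig : ∀ (K k : ℕ) (Z : (domSys (F.P K) M (k + 1)).Dom), sp K (k + 1) Z ⊆ big K (k + 1) Z)
    (c : B13.Consts) (hL : 8 ≤ c.L) (hLc : c.L = L) (hκ₁ : 1 ≤ c.κ₁) (hα₆ : c.α₆ ≠ 0) {a a₂ a₂' a₅ Aabs : ℝ} (hN : Lemma3Numerics c M ((c.L : ℝ) / 2) a a₂ a₂' a₅ Aabs)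
    {D : ℕ → Set ℂ}
    (hloc18 : ∀ (K k : ℕ), ∀ s ∈ D K, ∀ old : OlderTerms (F.P K) 𝔸 M k,
      (∀ (j : Fin (k + 1)) (Y : (domSys (F.P K) M j).Dom), ∀ ψ ∈ sp K j Y, ‖old j Y ψ‖ ≤ E₀ * Real.exp (-(r₁ * (domSys (F.P K) M j).dj Y))) →
      (∀ (j : Fin (k + 1)) (Y : (domSys (F.P K) M j).Dom), AnalyticOnNhd ℂ (old j Y) (sp K j Y)) →
      ∀ (Z : (domSys (F.P K) M (k + 1)).Dom), ∀ t ∈ terms L M Z, ∀ φ₁ ∈ big K (k + 1) Z, ∃ ι : (𝔇 K k).Inputs226Holo c Z t s old φ₁ a a₅,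
        (∀ φ ∈ big K (k + 1) Z, ∀ i j, DifferentiableOn ℂ (fun σ => (𝔇 K k).A Z t φ σ i j) {σ | ∀ j, σ j ∈ ι.Uσ}) ∧
        (∀ φ ∈ big K (k + 1) Z, ∀ i j, DifferentiableOn ℂ (fun σ => ((𝔇 K k).𝒦 Z t).G2 σ ((𝔇 K k).uOf Z t φ) i j) {σ | ∀ j, σ j ∈ ι.Uσ}) ∧
        (∀ σ : TPt (F.P K).d (domCount (F.P K) M (k + 1)) → ℂ, (∀ j, σ j ∈ ι.Uσ) → ∀ i j, DifferentiableOn ℂ (fun φ => (𝔇 K k).A Z t φ σ i j) (big K (k + 1) Z)) ∧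
        (∀ σ : TPt (F.P K).d (domCount (F.P K) M (k + 1)) → ℂ, (∀ j, σ j ∈ ι.Uσ) →
          ∀ i j, DifferentiableOn ℂ (fun φ => ((𝔇 K k).𝒦 Z t).G2 σ ((𝔇 K k).uOf Z t φ) i j) (big K (k + 1) Z)) ∧
        (∀ Y B, DifferentiableOn ℂ (fun φ => (𝔇 K k).𝒱 Z t s old φ Y B) (big K (k + 1) Z)) ∧
        (∀ φ ∈ big K (k + 1) Z, ∀ Y, Measurable ((𝔇 K k).𝒱 Z t s old φ Y)) ∧
        (∀ φ ∈ big K (k + 1) Z, ∀ σ : TPt (F.P K).d (domCount (F.P K) M (k + 1)) → ℂ, (∀ j, σ j ∈ ι.Uσ) → ((𝔇 K k).A Z t φ σ).IsSymm) ∧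
        (∀ φ ∈ big K (k + 1) Z, ∀ σ : TPt (F.P K).d (domCount (F.P K) M (k + 1)) → ℂ, (∀ j, σ j ∈ ι.Uσ) → (((𝔇 K k).A Z t φ σ).map Complex.re).PosDef) ∧
        (∀ φ ∈ big K (k + 1) Z, ∀ τ : TDom (F.P K).d (L * domCount (F.P K) M (k + 1)) → ℂ, (∀ Y, τ Y ∈ ι.Uτ Y) →
          ∀ B, ∑ Y ∈ t.1, ‖τ Y‖ * ‖(𝔇 K k).𝒱 Z t s old φ Y B‖ ≤ ι.a₂₀ / 2 * (B ⬝ᵥ B) + ι.w) ∧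
        (∀ φ ∈ big K (k + 1) Z, ∀ σ : TPt (F.P K).d (domCount (F.P K) M (k + 1)) → ℂ, (∀ j, σ j ∈ ι.Uσ) → ∀ b j, ‖((𝔇 K k).𝒦 Z t).G2 σ ((𝔇 K k).uOf Z t φ) b j‖ ≤
            ι.KG * Real.exp (-(ι.kap * tdist1 (𝔇 K k).Nf (((𝔇 K k).𝒦 Z t).locΛ b) (((𝔇 K k).𝒦 Z t).locN j)))) ∧
        (∀ φ ∈ big K (k + 1) Z, ∀ σ : TPt (F.P K).d (domCount (F.P K) M (k + 1)) → ℂ, (∀ j, σ j ∈ ι.Uσ) → ∀ b b', ‖((𝔇 K k).A Z t φ σ)⁻¹ b b'‖ ≤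
            ι.KCs * Real.exp (-(ι.kap * tdist1 (𝔇 K k).Nf (((𝔇 K k).𝒦 Z t).locΛ b) (((𝔇 K k).𝒦 Z t).locΛ b')))) ∧
        (∀ φ ∈ big K (k + 1) Z, ∀ σ : TPt (F.P K).d (domCount (F.P K) M (k + 1)) → ℂ, (∀ j, σ j ∈ ι.Uσ) →
          ∀ b j, ‖(((𝔇 K k).𝒦 Z t).G2 σ ((𝔇 K k).uOf Z t φ) - ((𝔇 K k).𝒦 Z t).Γ₀.map (algebraMap ℝ ℂ)) b j‖ ≤
            ι.θΓ * Real.exp (-(ι.kap * tdist1 (𝔇 K k).Nf (((𝔇 K k).𝒦 Z t).locΛ b) (((𝔇 K k).𝒦 Z t).locN j)))) ∧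
        (∀ φ ∈ big K (k + 1) Z, ∀ σ : TPt (F.P K).d (domCount (F.P K) M (k + 1)) → ℂ, (∀ j, σ j ∈ ι.Uσ) →
          ∀ b b', ‖(((𝔇 K k).A Z t φ σ)⁻¹ - ((𝔇 K k).𝒦 Z t).C.map (algebraMap ℝ ℂ)) b b'‖ ≤
            ι.θC * Real.exp (-(ι.kap * tdist1 (𝔇 K k).Nf (((𝔇 K k).𝒦 Z t).locΛ b) (((𝔇 K k).𝒦 Z t).locΛ b')))) ∧
        (∀ φ ∈ big K (k + 1) Z, ∀ σ : TPt (F.P K).d (domCount (F.P K) M (k + 1)) → ℂ, (∀ j, σ j ∈ ι.Uσ) →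
          ∀ b b', ‖((𝔇 K k).A Z t φ σ - ((𝔇 K k).𝒦 Z t).C⁻¹.map (algebraMap ℝ ℂ)) b b'‖ ≤
            ι.θE * Real.exp (-(ι.kap * tdist1 (𝔇 K k).Nf (((𝔇 K k).𝒦 Z t).locΛ b) (((𝔇 K k).𝒦 Z t).locΛ b')))))
    (hD : ∀ K, ∀ t ∈ Ioc (0 : ℝ) θ.γ, ((t : ℝ) : ℂ) ∈ D K)
    {S : ℕ → ℕ → Type} [∀ K k, MeasurableSpace (S K k)] [∀ K k, TopologicalSpace (S K k)] [∀ K k, OpensMeasurableSpace (S K k)]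
    (χu χcu : (K k : ℕ) → (𝔇 K k).UnscaledChi) (𝒲 : (K k : ℕ) → (𝔇 K k).UnscaledWilson) (𝒪 : (K k : ℕ) → (𝔇 K k).UnscaledOlder)
    (Rd : (K k : ℕ) → (Z : (domSys (F.P K) M (k + 1)).Dom) → (t : TermLabel (F.P K) M k L) → (𝔇 K k).ReadingAtoms Z t (S K k))
    (W : (K k : ℕ) → (domSys (F.P K) M (k + 1)).Dom → TermLabel (F.P K) M k L → Set (CPair (F.P K) 𝔸))
    (hlaw : ∀ K, (𝔇 K).UnscaledFieldLawOn (χu K) (χcu K) (𝒲 K) (𝒪 K) θ.γ) (hread : ∀ K k, (𝔇 K k).ReadsBy (𝒪 K k) (Rd K k))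
    (hmaps : ∀ (K k : ℕ) (Z : (domSys (F.P K) M (k + 1)).Dom) (t : TermLabel (F.P K) M k L), (Rd K k Z t).MapsToTables (sp K) (W K k Z t) univ)
    (hW : ∀ (K k : ℕ) (X Z : (domSys (F.P K) M (k + 1)).Dom), Subtype.val Z ⊆ Subtype.val X → ∀ s ∈ terms L M Z, sp K (k + 1) X ⊆ W K k Z s)
    (hcont : ∀ (K k : ℕ) (Z : (domSys (F.P K) M (k + 1)).Dom) (t : TermLabel (F.P K) M k L), (Rd K k Z t).CfgContinuous)
    (hjc : ∀ (K k : ℕ) (Z : (domSys (F.P K) M (k + 1)).Dom) (t : TermLabel (F.P K) M k L), (Rd K k Z t).CfgJointContinuous)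
    {Ck mk : ℝ} (hK : ∀ (K k : ℕ) (Z : (domSys (F.P K) M (k + 1)).Dom) (t : TermLabel (F.P K) M k L), (Rd K k Z t).KernelBounded Ck)
    (hμ : ∀ (K k : ℕ) (Z : (domSys (F.P K) M (k + 1)).Dom) (t : TermLabel (F.P K) M k L), (Rd K k Z t).FiniteMass mk) (hCk : 0 ≤ Ck) (hmk : 0 ≤ mk)
    (hWm : ∀ (K k : ℕ) (Z : (domSys (F.P K) M (k + 1)).Dom) (t : TermLabel (F.P K) M k L) (φ : CPair (F.P K) 𝔸) (Y : TDom (F.P K).d (L * domCount (F.P K) M (k + 1))),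
      Measurable fun B : ((𝔇 K k).𝒦 Z t).Λ → ℝ => 𝒲 K k Z t φ Y B)
    {b : ℝ} (hb : 0 < b) (hbaw : ∀ K k j, b ≤ aw K k j)
    (hι : ∀ (K k : ℕ), ∀ t ∈ Ioc (0 : ℝ) θ.γ, ∀ (X : (domSys (F.P K) M (k + 1)).Dom), ∀ φ ∈ sp K (k + 1) X,
      ∀ Z : (domSys (F.P K) M (k + 1)).Dom, Subtype.val Z ⊆ Subtype.val X → ∀ s ∈ terms L M Z,
        ∃ old₀ ∈ AdmHist (sp K) E₀ r₁ k, ∃ ι : (𝔇 K k).Inputs226Holo c Z s ((t : ℝ) : ℂ) old₀ φ a a₅, ∃ w₀ : ℝ,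
          (∀ τ : TDom (F.P K).d (L * domCount (F.P K) M (k + 1)) → ℂ, (∀ Y, τ Y ∈ ι.Uτ Y) → ∀ B : ((𝔇 K k).𝒦 Z s).Λ → ℝ,
            ∑ Y ∈ s.1, ‖τ Y‖ * ‖(𝔇 K k).𝒱 Z s ((t : ℝ) : ℂ) old₀ φ Y B‖ ≤ ι.a₂₀ / 2 * (B ⬝ᵥ B) + w₀) ∧
          w₀ + (∑ Y ∈ s.1, ((B13Bound143.invTau c ((tsys (F.P K).d (L * domCount (F.P K) M (k + 1))).dj Y))⁻¹ + (𝔇 K k).r + 2)) *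
            ((∑ _j : Fin (k + 1), ∑ _X : (domSys (F.P K) M _j).Dom, Ck) * mk * (E₀ + b⁻¹ * R)) ≤ ι.w)
    (hA0 : 0 ≤ c.C3act * c.ε₁) (hr₁ : 0 ≤ r₁) (hrate : r₁ + 2 * (64 * Real.log 162) + 2 ≤ (1 - 8 * c.δ) * ((c.L : ℝ) / 2) * c.κ)
    (hKP : c.C3act * c.ε₁ * Real.exp (5 * r₁ + 1) * K₀ 64 8 * 9 * 64 < 1) (hκr : κE ≤ r₁) (hrenew : Real.exp 1 * 9 * 64 * K₀ 64 8 ^ 2 * (c.C3act * c.ε₁) ≤ Mb)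
    (hrenewE : Real.exp 1 * 9 * 64 * K₀ 64 8 ^ 2 * (c.C3act * c.ε₁) ≤ E₀)
    (hawcw : ∀ K k j, aw K k j ≤ cw) (hC1 : 4 * Mb * cw / ϱ < 1)
    (hMb0 : 0 ≤ Mb) (hϱ : 0 < ϱ) (hR : cw * E₀ + ϱ < R)
    {cA ρb Mv : ℝ} (hcS : 0 < cS) (hcSA : cS < cA) (hcA1 : cA < 1) (hρb : cA / (1 - cA) < ρb) (hBq : 0 ≤ Bq)
    (hsmall2 : 2 * (c.C3act * c.ε₁) * Real.exp (5 * r₁ + 1) * K₀ 64 8 * 9 * 64 ≤ 1)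
    (T₀ : (K k : ℕ) → (domSys (F.P K) M (k + 1)).Dom → TermLabel (F.P K) M k L → OlderTerms (F.P K) 𝔸 M k → CPair (F.P K) 𝔸 → ℂ) (hMv : 0 ≤ Mv)
    (hBqv : 2 * (Real.exp 1 * 9 * 64 * K₀ 64 8 ^ 2 * (2 * (c.C3act * c.ε₁))) * ((1 - cA)⁻¹ ^ 2 * Mv) * (1 + cS) ^ 2 ≤ Bq)
    (hρb1 : ρb < 1)
    (hιm : ∀ (K k : ℕ) (old : OlderTerms (F.P K) 𝔸 M k), old ∈ AdmHist (sp K) E₀ r₁ k ∧ old 0 = 0 → ∀ (X : (domSys (F.P K) M (k + 1)).Dom), ∀ φ ∈ sp K (k + 1) X,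
      ∀ Z : (domSys (F.P K) M (k + 1)).Dom, Subtype.val Z ⊆ Subtype.val X → ∀ s ∈ terms L M Z, ∀ t ∈ Ioc (0 : ℝ) θ.γ,
        ∃ ι : (𝔇 K k).Inputs226Holo c Z s ((t : ℝ) : ℂ) old φ a a₅, ∃ KE KG' KCs' θΓ' θC' θE' a' w' : ℝ,
          0 ≤ KE ∧
          (∀ b b', ‖(((𝔇 K k).𝒦 Z s).C⁻¹.map (algebraMap ℝ ℂ)) b b'‖ ≤
            KE * Real.exp (-(ι.kap * tdist1 (𝔇 K k).Nf (((𝔇 K k).𝒦 Z s).locΛ b) (((𝔇 K k).𝒦 Z s).locΛ b')))) ∧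
          (∀ Y, Measurable fun B : ((𝔇 K k).𝒦 Z s).Λ → ℝ => 𝒲 K k Z s φ Y (t • B)) ∧
          (∀ Y, Measurable fun B : ((𝔇 K k).𝒦 Z s).Λ → ℝ => 𝒪 K k Z s old φ Y (t • B)) ∧
          (∀ τ : TDom (F.P K).d (L * domCount (F.P K) M (k + 1)) → ℂ, (∀ Y, τ Y ∈ ι.Uτ Y) → ∀ B : ((𝔇 K k).𝒦 Z s).Λ → ℝ,
            ∑ Y ∈ s.1, ‖τ Y‖ * (‖(((t : ℝ) : ℂ) ^ 2)⁻¹ * 𝒲 K k Z s φ Y (t • B)‖ + ‖𝒪 K k Z s old φ Y (t • B)‖) ≤ ι.a₂₀ / 2 * (B ⬝ᵥ B) + ι.w) ∧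
          (1 + ρb) * ι.KG ≤ KG' ∧ ((1 - ρb) ^ 2)⁻¹ * ι.KCs ≤ KCs' ∧ ι.θΓ + ρb * ι.KG ≤ θΓ' ∧
          ι.θC + ρb * (2 + ρb) * ((1 - ρb) ^ 2)⁻¹ * ι.KCs ≤ θC' ∧ ι.θE + ρb * (2 + ρb) * (ι.θE + KE) ≤ θE' ∧
          (1 + ρb) ^ 2 * ι.a₂₀ ≤ a' ∧ (1 + ρb) ^ 2 * ι.w ≤ w' ∧ θE' ≤ ι.θ ∧ θΓ' ≤ ι.θ ∧
          ((((𝔇 K k).𝒦 Z s).m * (1 + 2 / (ι.kap - ι.kap')) ^ (𝔇 K k).ν) * (((𝔇 K k).𝒦 Z s).m * (1 + 2 / (ι.kap' - ι.kap'')) ^ (𝔇 K k).ν)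
            * (θΓ' * KCs' * KG' + ι.KΓ * θC' * KG' + ι.KΓ * ι.K₀ * θΓ') ≤ ι.θ) ∧
          (2 * (ι.θ * (((𝔇 K k).𝒦 Z s).m * (1 + 2 / ι.kap'') ^ (𝔇 K k).ν)) + (ι.γ₂ + a')) * ι.cE ≤ 1 / 2 ∧
          (2 * (ι.θ * (((𝔇 K k).𝒦 Z s).m * (1 + 2 / ι.kap'') ^ (𝔇 K k).ν)) + (ι.γ₂ + a')) * (1 + 2 * ι.cE * ι.g) ≤ 1 / 2 ∧
          2 * (ι.K₀ * (((𝔇 K k).𝒦 Z s).m * (1 + 2 / ι.kap) ^ (𝔇 K k).ν) * (ι.θ * (((𝔇 K k).𝒦 Z s).m * (1 + 2 / ι.kap'') ^ (𝔇 K k).ν))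
              * (1 + (1 - ι.K₀ * (((𝔇 K k).𝒦 Z s).m * (1 + 2 / ι.kap) ^ (𝔇 K k).ν) * (ι.θ * (((𝔇 K k).𝒦 Z s).m * (1 + 2 / ι.kap'') ^ (𝔇 K k).ν)))⁻¹) / 2)
              * (Fintype.card ((𝔇 K k).𝒦 Z s).Λ : ℝ)
            + w' + (2 * (ι.θ * (((𝔇 K k).𝒦 Z s).m * (1 + 2 / ι.kap'') ^ (𝔇 K k).ν)) + (ι.γ₂ + a')) * ι.cE * (Fintype.card ((𝔇 K k).𝒦 Z s).Λ : ℝ)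
            + (2 * (ι.θ * (((𝔇 K k).𝒦 Z s).m * (1 + 2 / ι.kap'') ^ (𝔇 K k).ν)) + (ι.γ₂ + a')) * (1 + 2 * ι.cE * ι.g)
              * (Fintype.card (((𝔇 K k).𝒦 Z s).Λ ⊕ ((𝔇 K k).𝒦 Z s).C₀) : ℝ)
            ≤ a₅ * ((Z.1).card : ℝ))
    (hT₀ : ∀ (K k : ℕ) (old : OlderTerms (F.P K) 𝔸 M k), old ∈ AdmHist (sp K) E₀ r₁ k ∧ old 0 = 0 → ∀ (X : (domSys (F.P K) M (k + 1)).Dom), ∀ φ ∈ sp K (k + 1) X,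
      ∀ Z : (domSys (F.P K) M (k + 1)).Dom, Subtype.val Z ⊆ Subtype.val X → ∀ s ∈ terms L M Z, ‖T₀ K k Z s old φ‖ ≤ weight L M c Z a s * Real.exp (a₅ * ((Z.1).card : ℝ)))
    (hMcen : ∀ (K k : ℕ) (old : OlderTerms (F.P K) 𝔸 M k), old ∈ AdmHist (sp K) E₀ r₁ k ∧ old 0 = 0 → ∀ (X : (domSys (F.P K) M (k + 1)).Dom), ∀ φ ∈ sp K (k + 1) X,
      ∀ Z : (domSys (F.P K) M (k + 1)).Dom, Subtype.val Z ⊆ Subtype.val X → ∀ s ∈ terms L M Z, ∀ t ∈ Ioc (0 : ℝ) θ.γ, ∀ b ∈ ball (1 : ℂ) ρb,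
        ‖(𝔇 K).memberTF (χu K) (χcu K) (𝒲 K) (𝒪 K) t k Z s b old φ - T₀ K k Z s old φ‖ ≤ Mv * t ^ 2 * (weight L M c Z a s * Real.exp (a₅ * ((Z.1).card : ℝ))))
    (Ec : ℕ → ℕ → Type*) [∀ K k, NormedAddCommGroup (Ec K k)] [∀ K k, NormedSpace ℂ (Ec K k)]
    (ι : letI := θ.instVβ₁; letI := θ.instVβ₂
      (K k : ℕ) → (domSys (F.P K) M (k + 1)).Dom → ((Fin (F.P K).d → Site (F.P K) (k + 1) → θ.Vβ) →L[ℝ] Ec K k))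
    (Φ : (K k : ℕ) → (domSys (F.P K) M (k + 1)).Dom → Ec K k → CPair (F.P K) 𝔸)
    (U : (K k : ℕ) → (domSys (F.P K) M (k + 1)).Dom → Set (Ec K k)) (hU : ∀ K k X, IsOpen (U K k X)) (hrU : ∀ K k X, ball (0 : Ec K k) r ⊆ U K k X)
    (hΦhol : ∀ (K k : ℕ) (X : (domSys (F.P K) M (k + 1)).Dom), DifferentiableOn ℂ (Φ K k X) (U K k X))
    (hΦemb : letI := θ.instVβ₁; letI := θ.instVβ₂
      ∀ (K k : ℕ) (X : (domSys (F.P K) M (k + 1)).Dom) (Bf : Fin (F.P K).d → Site (F.P K) (k + 1) → θ.Vβ),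
        Φ K k X (ι K k X Bf) = emb K k (fun l t => NormedSpace.exp (θ.ρ8 (Bf l t))))
    (hΦsp : ∀ (K k : ℕ) (X : (domSys (F.P K) M (k + 1)).Dom), ∀ z ∈ U K k X, ∀ Z : (domSys (F.P K) M (k + 1)).Dom, Z.1 ⊆ X.1 → Φ K k X z ∈ sp K (k + 1) Z)
    (w : (K k : ℕ) → (domSys (F.P K) M (k + 1)).Dom → Site (F.P K) (k + 1) → ℝ) (hw₀ : ∀ K k X t, 0 ≤ w K k X t)
    (hw : letI := θ.instVβ₁; letI := θ.instVβ₂; letI := θ.instιβ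
      ∀ (K k : ℕ) (X : (domSys (F.P K) M (k + 1)).Dom) (l : Fin (F.P K).d) (t : Site (F.P K) (k + 1)) (c : θ.ιβ),
        ‖ι K k X (Pi.single l (Pi.single t (θ.bV c)))‖ ≤ w K k X t)
    (htail : ∀ (K k : ℕ) (X : (domSys (F.P K) M (k + 1)).Dom) (t : Site (F.P K) (k + 1)),
      let e : Site (F.P K) (k + 1) → TPt 4 (domCount (F.P K) M (k + 1) * M) := fun x i => (ZMod.cast (x i) : ZMod (domCount (F.P K) M (k + 1) * M))
      w K k X t ≤ B₃ * Real.exp (-δ₀ * distCT (domCount (F.P K) M (k + 1)) M (e t) (nearT (M := M) (e t) X)))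
    (hκ₅ : delta1 δ₀ κ ((M : ℝ) * 4) ≤ κ₅)
    (hω : 0 < ℓ.ω) (hθω : ℓ.θ₅ ≤ ℓ.ω ^ 2) (hℓκ : ℓ.κ ≤ delta1 δ₀ κ ((M : ℝ) * 4))
    (hC₉ : (4 * (2 * C₅ / (1 - ℓ.θ₅) + 2 * ((16 * Mb * B₃ ^ 2 / r ^ 2) * Real.exp (delta1 δ₀ κ ((M : ℝ) * 4) * ((M : ℝ) * 4) * 3) * K₀ (4 * 2 ^ 4) (2 * 4) * K₁ 4 (δ₀ / 2))) / θ.γ +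
        ((16 * max ((6 * cS ^ 2 + 32 * cS + 64) / cS ^ 2 * Bq) (64 * Mb * cw ^ 2 / ϱ ^ 2 * (Bq * θ.γ / cS) ^ 2 / (1 - 4 * Mb * cw / ϱ)) * B₃ ^ 2 / r ^ 2) * Real.exp (delta1 δ₀ κ ((M : ℝ) * 4) * ((M : ℝ) * 4) * 3) * K₀ (4 * 2 ^ 4) (2 * 4) *
          K₁ 4 (δ₀ / 2)) * θ.γ / 2) / ℓ.ω ≤ ℓ.C₉) (k : ℕ) :
    N22At (u3OfRecord₁₃ θ (objectsOfRecord₁₃ F N θ ℓ) k) := by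
  -- per slice and base point: ι + extras ⟹ (hMdiff) ∧ (hMbd) by g7 J6, the unscaled boxes at the base point read off ι's box rows by the law
  have hMem : ∀ (K k : ℕ) (old : OlderTerms (F.P K) 𝔸 M k), old ∈ AdmHist (sp K) E₀ r₁ k ∧ old 0 = 0 → ∀ (X : (domSys (F.P K) M (k + 1)).Dom), ∀ φ ∈ sp K (k + 1) X,
      ∀ Z : (domSys (F.P K) M (k + 1)).Dom, Subtype.val Z ⊆ Subtype.val X → ∀ s ∈ terms L M Z, ∀ t ∈ Ioc (0 : ℝ) θ.γ,
        DifferentiableOn ℂ (fun b => (𝔇 K).memberTF (χu K) (χcu K) (𝒲 K) (𝒪 K) t k Z s b old φ) (ball (1 : ℂ) ρb) ∧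
        ∀ b ∈ ball (1 : ℂ) ρb, ‖(𝔇 K).memberTF (χu K) (χcu K) (𝒲 K) (𝒪 K) t k Z s b old φ‖ ≤ weight L M c Z a s * Real.exp (a₅ * ((Z.1).card : ℝ)) := by
    intro K k old hold X φ hφ Z hZ s hs t ht
    obtain ⟨ι, KE, KG', KCs', θΓ', θC', θE', a', w', hKE, hCE, hWm', hOm', h220W, hKG', hKCs', hθΓ', hθC', hθE', ha', hw', hθEle, hθΓle, hθR1le, hαc, hsmall',
      hvol⟩ := hιm K k old hold X φ hφ Z hZ s hs t ht
    have Eχ : ∀ B, (𝔇 K k).chiY₀ Z s ((t : ℝ) : ℂ) B = χu K k Z s (t • B) := fun B => (hlaw K k).chiY₀_eq (𝔇 K k) Z s ht B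
    have Eχc : ∀ B, (𝔇 K k).chicP Z s ((t : ℝ) : ℂ) B = χcu K k Z s (t • B) := fun B => (hlaw K k).chicP_eq (𝔇 K k) Z s ht B
    have Fχ : (fun B => χu K k Z s (t • B)) = (𝔇 K k).chiY₀ Z s ((t : ℝ) : ℂ) := funext fun B => (Eχ B).symm
    have Fχc : (fun B => χcu K k Z s (t • B)) = (𝔇 K k).chicP Z s ((t : ℝ) : ℂ) := funext fun B => (Eχc B).symm
    exact differentiableOn_and_norm_memberOfDatum_le_weight_of_primitives (𝔇 K k) (χu K k) (χcu K k) (𝒲 K k) (𝒪 K k) c hκ₁ hα₆ Z s old φ t ι.hpos ι.hhalf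
      ι.hUσ ι.hUτ ι.hUexp ι.hUtau ι.hr ι.hr' ι.hsubτ (fun B => by rw [← Eχ B]; exact ι.hχ0 B) (fun B => by rw [← Eχc B]; exact ι.hχc0 B)
      (by rw [Fχ]; exact ι.hχm) (by rw [Fχc]; exact ι.hχcm) ι.qP (fun B => by rw [← Eχ B, ← Eχc B]; exact ι.h222 B) ι.hγ₂ ι.hqP ι.ha0 hWm' hOm' h220W
      ι.hAhol ι.hGhol ι.hAs ι.hfibN ι.hkap'' ι.h1 ι.h2 ι.hθE ι.hθΓ ι.hθC ι.hKG ι.hKΓ ι.hKCs ι.hK₀ hKE ι.hG ι.hΓ₀ ι.hCs ι.hC216 hCE ι.hdΓ ι.hdC ι.hdE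
      hρb1 hKG' hKCs' hθΓ' hθC' hθE' ha' hw' hθEle hθΓle hθR1le ι.hsmallKθ ι.hc0 ι.hc hαc ι.hg ι.hΓq hsmall' ι.hPa hvol
  exact n22At_u3OfRecord₁₃_of_kernelStepRate_termDataTableGermsLocatedRadiiDilatedMembersNonexpansive F N
    θ ℓ hs hγ hlim hC₅ h5 m' M hM 𝔇 emb hloc sp hsp hκ₀ hδ₀ hB₃ hr hκE hκE0 hE₀ big hbigo hrestr hbig c hL hLc hκ₁ hα₆ hN hloc18 hD χu χcu 𝒲 𝒪 Rd W hlaw hread hmaps hW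
    hcont hjc hK hμ hCk hmk hWm hb hbaw hι hA0 hr₁ hrate hKP hκr hrenew hrenewE hawcw hC1 hMb0 hϱ hR hcS hcSA hcA1 hρb hBq hsmall2 T₀ hMv hBqv
    (fun K k old hold X φ hφ Z hZ s hs t ht => (hMem K k old hold X φ hφ Z hZ s hs t ht).1)
    (fun K k old hold X φ hφ Z hZ s hs t ht => (hMem K k old hold X φ hφ Z hZ s hs t ht).2)
    hT₀ hMcen Ec ι Φ U hU hrU hΦhol hΦemb hΦsp w hw₀ hw htail hκ₅ hω hθω hℓκ hC₉ k

end YMDAG.N22.KernelFading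

end
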